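import Mathlib
import HarnessLib
import Literature.MathematicalPhysics.QuantumFieldTheory.ConstructiveQFTWave0
import Literature.MathematicalPhysics.QuantumFieldTheory.LatticeGaugeProofs
import Literature.MathematicalPhysics.QuantumFieldTheory.StrongCouplingActivities
import Summits.Ventures.LatticeQCDFlow.Scaling.PlaquetteIndependence2D
import Summits.Ventures.LatticeQCDFlow.Scaling.PlaquetteDecorrelationTwoDimU1
import Summits.Ventures.LatticeQCDFlow.Scaling.PlaquetteDecorrelationTwoDim

/-!
# LatticeQCDFlow / Scaling — two dimensions, every compact gauge group: the covariance of two plaquette observables of the Wilson measure is `O(q^{L²})`, uniformly in the sites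

HONEST FRAMING: exact (Metropolis-corrected) sampling algorithms for lattice gauge theory; figures of merit are
autocorrelation/cost numbers at stated couplings and volumes; no continuum-physics claim.

Venture `LatticeQCDFlow` (cell pub-lqcd), topic `Scaling`, FANOUT row 30 (lean-1) — OUR WORK.  The one-bad-set
expansion of `Scaling/PlaquetteDecorrelationTwoDim.lean` (`pair_lintegral_upper/lower`: for ANY compact second-countable
`G` and any weight `w = c + v`, `v ≤ s`, the pair integrals of `(∏_x w(U_x))·Haar^{⊗E}` on `(ℤ/L)²` are pinned between
`a·b·((c+y)^{L²−2} − y^{L²−2})` and `a·b·((c+y)^{L²−2} + s·y^{L²−3})`, `y = m(v)`) applied to the Wilson weight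
`w(g) = e^{−β(N − Re tr ρ(g))}` of a CONTINUOUS representation `ρ` at ANY real `β`:

* `tendsto_sq_sub_atTop`, **`ratio_tendsto_one`** — `r_L := (z^{L²−2} − y^{L²−2})/(z^{L²−2} + s·y^{L²−3}) → 1` for
  `0 ≤ y < z`, `0 ≤ s` (`q = y/z < 1`; the convergence is exponential in the volume `L²`);
* `wilson_oneWeight_bounds` — `e^{−|β|(N+M)} ≤ w ≤ e^{|β|(N+M)}`, `M = sup |Re tr ρ|` (`exists_bound_trace_re_nonneg`);
* **`wilson_abs_cov_pair_nonneg`** — with `c = e^{−|β|(N+M)}`, `v = w − c`, `y = m(v)`, `z = c + y = m(w)`, `s = e^{|β|(N+M)}`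
  and `r = r_L` as above (`0 < r_L ≤ 1` for `L ≥ 2`, `r_L → 1`): for every `L ≥ 2`, ALL sites `p ≠ p'` and all measurable
  `0 ≤ φ ≤ A`, `0 ≤ ψ ≤ B`,
  `|∫ φ(U_p)ψ(U_{p'}) dμ_{β,L} − ∫ φ(U_p) dμ_{β,L} · ∫ ψ(U_{p'}) dμ_{β,L}| ≤ (r_L⁻² − r_L)·AB` — each of the three
  expectations is within `r_L^{±1}` of its value under independent one-plaquette laws `w dHaar/z` (the partition function
  is the pair integral with `Φ = Ψ = 1`), then the real sandwich `abs_sub_mul_le_of_sandwich` of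
  `PlaquetteDecorrelationTwoDimU1`.

The signed / packaged form and the refutation of the venture's items (U′)/(U″) in `d = 2` for every compact `G` are
`Scaling/CorrelatorFloorTwoDim.lean`.  (`G : Type`, as in the conjecture items.)  Literature grade: known physics
(two-dimensional lattice gauge theory is solvable; Migdal 1975, Gross–Witten 1980); new = a kernel-checked,
character-free, volume-uniform covariance bound for every compact gauge group.  Elementary given the tree; nothing here
is cited as a fact; no `def`, no `sorry`.
-/

noncomputable section

namespace Summit.Ventures.LatticeQCDFlow.Theory2.Lattice.TwoDim

open MeasureTheory Filter Topology Literature.MathematicalPhysics.QuantumFieldTheory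
open scoped ENNReal

/-! ## §1. The decorrelation ratio tends to one -/

/-- `L² − k → ∞`. [folklore] -/
theorem tendsto_sq_sub_atTop (k : ℕ) : Tendsto (fun L : ℕ => L ^ 2 - k) atTop atTop := by
  refine tendsto_atTop_atTop.mpr fun b => ⟨b + k, fun L hL => ?_⟩
  have h1 : L ≤ L ^ 2 := by nlinarith
  omega

/-- **The ratio `(z^{L²−2} − y^{L²−2})/(z^{L²−2} + s·y^{L²−3}) → 1`** for `0 ≤ y < z`, `0 ≤ s`. [folklore] -/
theorem ratio_tendsto_one {z y s : ℝ} (hy0 : 0 ≤ y) (hyz : y < z) (hs : 0 ≤ s) :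
    Tendsto (fun L : ℕ => (z ^ (L ^ 2 - 2) - y ^ (L ^ 2 - 2)) / (z ^ (L ^ 2 - 2) + s * y ^ (L ^ 2 - 3)))
      atTop (𝓝 1) := by
  have hz : 0 < z := lt_of_le_of_lt hy0 hyz
  set q : ℝ := y / z with hq
  have hq0 : 0 ≤ q := div_nonneg hy0 hz.le
  have hq1 : q < 1 := (div_lt_one hz).mpr hyz
  have hpow2 : Tendsto (fun L : ℕ => q ^ (L ^ 2 - 2)) atTop (𝓝 0) :=
    (tendsto_pow_atTop_nhds_zero_of_lt_one hq0 hq1).comp (tendsto_sq_sub_atTop 2)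
  have hpow3 : Tendsto (fun L : ℕ => q ^ (L ^ 2 - 3)) atTop (𝓝 0) :=
    (tendsto_pow_atTop_nhds_zero_of_lt_one hq0 hq1).comp (tendsto_sq_sub_atTop 3)
  have hlim : Tendsto (fun L : ℕ => (1 - q ^ (L ^ 2 - 2)) / (1 + s / z * q ^ (L ^ 2 - 3))) atTop (𝓝 1) := by
    have h1 : Tendsto (fun L : ℕ => (1 : ℝ) - q ^ (L ^ 2 - 2)) atTop (𝓝 (1 - 0)) := hpow2.const_sub 1
    have h2 : Tendsto (fun L : ℕ => (1 : ℝ) + s / z * q ^ (L ^ 2 - 3)) atTop (𝓝 (1 + s / z * 0)) :=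
      (hpow3.const_mul (s / z)).const_add 1
    have h := h1.div h2 (by norm_num : (1 : ℝ) + s / z * 0 ≠ 0)
    rw [sub_zero, mul_zero, add_zero, div_one] at h
    exact h
  refine hlim.congr' ?_
  filter_upwards [eventually_ge_atTop 2] with L hL
  have hn : L ^ 2 - 2 = (L ^ 2 - 3) + 1 := by
    have : 4 ≤ L ^ 2 := by nlinarith
    omega
  have hzn : (0 : ℝ) < z ^ (L ^ 2 - 3) := pow_pos hz _
  rw [hn, hq, div_pow, div_pow, pow_succ z, pow_succ y]
  field_simp

/-! ## §2. The Wilson weight in the form `c + v` -/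

variable {L N : ℕ} {G : Type} [Group G] [TopologicalSpace G] [IsTopologicalGroup G] [CompactSpace G]
  [SecondCountableTopology G] [MeasurableSpace G] [BorelSpace G] (ρ : G →* Matrix (Fin N) (Fin N) ℂ)

omit [IsTopologicalGroup G] [SecondCountableTopology G] [MeasurableSpace G] [BorelSpace G] in
/-- **Two-sided bound on the Wilson one-plaquette weight** at any real `β`: with `M ≥ sup|Re tr ρ|`,
`e^{−|β|(N+M)} ≤ e^{−β(N − Re tr ρ(g))} ≤ e^{|β|(N+M)}`. [folklore] -/
theorem wilson_oneWeight_bounds (hρ : Continuous ρ) (β : ℝ) :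
    ∃ M : ℝ, 0 ≤ M ∧ ∀ g : G,
      Real.exp (-(|β| * ((N : ℝ) + M))) ≤ Real.exp (-(β * ((N : ℝ) - (ρ g).trace.re))) ∧
        Real.exp (-(β * ((N : ℝ) - (ρ g).trace.re))) ≤ Real.exp (|β| * ((N : ℝ) + M)) := by
  obtain ⟨M, hM0, hM⟩ := exists_bound_trace_re_nonneg ρ hρ
  refine ⟨M, hM0, fun g => ?_⟩
  have h1 : |β * ((N : ℝ) - (ρ g).trace.re)| ≤ |β| * ((N : ℝ) + M) := by
    rw [abs_mul]
    refine mul_le_mul_of_nonneg_left ?_ (abs_nonneg _)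
    have := hM g
    have h2 : |((N : ℝ) - (ρ g).trace.re)| ≤ (N : ℝ) + M := by
      refine (abs_sub _ _).trans ?_
      rw [Nat.abs_cast]; exact add_le_add le_rfl this
    exact h2
  constructor
  · exact Real.exp_le_exp.mpr (by linarith [le_abs_self (β * ((N : ℝ) - (ρ g).trace.re)), h1])
  · exact Real.exp_le_exp.mpr (by linarith [neg_le_abs (β * ((N : ℝ) - (ρ g).trace.re)), h1])

/-! ## §3. The covariance of a plaquette pair, every compact `G` -/

/-- **THE COVARIANCE OF A PLAQUETTE PAIR, non-negative observables** (2-d, any compact `G`, continuous `ρ`, any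
real `β`): a ratio `r_{ρ,β}(L)` with `0 < r ≤ 1` (`L ≥ 2`), `r → 1`, and
`|∫ φ(U_p)ψ(U_{p'}) dμ − ∫ φ(U_p) dμ · ∫ ψ(U_{p'}) dμ| ≤ (r⁻² − r)·AB` for every `L ≥ 2`, all `p ≠ p'`, all measurable
`0 ≤ φ ≤ A`, `0 ≤ ψ ≤ B`. [folklore] -/
theorem wilson_abs_cov_pair_nonneg (hρ : Continuous ρ) (β : ℝ) :
    ∃ r : ℕ → ℝ, (∀ L, 2 ≤ L → 0 < r L ∧ r L ≤ 1) ∧ Tendsto r atTop (𝓝 1) ∧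
      ∀ (L : ℕ) [NeZero L], 2 ≤ L → ∀ p p' : Site 2 L, p ≠ p' →
        ∀ φ ψ : G → ℝ, Measurable φ → Measurable ψ → ∀ A B : ℝ,
          (∀ g, 0 ≤ φ g) → (∀ g, φ g ≤ A) → (∀ g, 0 ≤ ψ g) → (∀ g, ψ g ≤ B) →
          |(∫ U, φ (plaquetteHolonomy U p 0 1) * ψ (plaquetteHolonomy U p' 0 1)
                ∂(wilsonMeasure (d := 2) (L := L) ρ β)) -
              (∫ U, φ (plaquetteHolonomy U p 0 1) ∂(wilsonMeasure (d := 2) (L := L) ρ β)) *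
              (∫ U, ψ (plaquetteHolonomy U p' 0 1) ∂(wilsonMeasure (d := 2) (L := L) ρ β))| ≤
            ((r L)⁻¹ ^ 2 - r L) * (A * B) := by
  classical
  obtain ⟨M, hM0, hM⟩ := wilson_oneWeight_bounds ρ hρ β
  -- the weight `w = c + v`
  set K : ℝ := |β| * ((N : ℝ) + M) with hK
  set cr : ℝ := Real.exp (-K) with hcr
  set sr : ℝ := Real.exp K with hsr
  have hcr0 : 0 < cr := Real.exp_pos _
  have hsr0 : 0 < sr := Real.exp_pos _
  set w : G → ℝ≥0∞ := fun g => ENNReal.ofReal (Real.exp (-(β * ((N : ℝ) - (ρ g).trace.re)))) with hw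
  set c : ℝ≥0∞ := ENNReal.ofReal cr with hc
  set sE : ℝ≥0∞ := ENNReal.ofReal sr with hsE
  have hwm : Measurable w := measurable_oneWeight ρ hρ β
  have hcw : ∀ g, c ≤ w g := fun g => ENNReal.ofReal_le_ofReal (hM g).1
  have hws : ∀ g, w g ≤ sE := fun g => ENNReal.ofReal_le_ofReal (hM g).2
  set v : G → ℝ≥0∞ := fun g => w g - c with hv
  have hvm : Measurable v := hwm.sub measurable_const
  have hcv : ∀ g, c + v g = w g := fun g => add_tsub_cancel_of_le (hcw g)
  have hvs : ∀ g, v g ≤ sE := fun g => tsub_le_self.trans (hws g)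
  have hct : c ≠ ⊤ := ENNReal.ofReal_ne_top
  have hsEt : sE ≠ ⊤ := ENNReal.ofReal_ne_top
  have hcvm : Measurable fun g => c + v g := measurable_const.add hvm
  -- Haar means
  set y : ℝ≥0∞ := ∫⁻ g, v g ∂(haarProbability G) with hy
  have hyle : y ≤ sE := by
    calc y ≤ ∫⁻ _, sE ∂(haarProbability G) := lintegral_mono fun g => hvs g
      _ = sE := by rw [lintegral_const, measure_univ, mul_one]
  have hyt : y ≠ ⊤ := ne_top_of_le_ne_top hsEt hyle
  have hcy : ∫⁻ g, c + v g ∂(haarProbability G) = c + y := by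
    rw [lintegral_add_right _ hvm, lintegral_const, measure_univ, mul_one]
  set yr : ℝ := y.toReal with hyr
  have hyr0 : 0 ≤ yr := ENNReal.toReal_nonneg
  set zr : ℝ := cr + yr with hzr
  have hzr0 : 0 < zr := by linarith
  have hyz : yr < zr := by linarith
  have hcyr : (c + y).toReal = zr := by rw [ENNReal.toReal_add hct hyt, hc, ENNReal.toReal_ofReal hcr0.le]
  have hsEr : sE.toReal = sr := ENNReal.toReal_ofReal hsr0.le
  -- the ratio
  set r : ℕ → ℝ := fun L => (zr ^ (L ^ 2 - 2) - yr ^ (L ^ 2 - 2)) / (zr ^ (L ^ 2 - 2) + sr * yr ^ (L ^ 2 - 3)) with hr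
  have hrpos : ∀ L, 2 ≤ L → 0 < zr ^ (L ^ 2 - 2) - yr ^ (L ^ 2 - 2) ∧ 0 < zr ^ (L ^ 2 - 2) + sr * yr ^ (L ^ 2 - 3) := by
    intro L hL
    have hn : L ^ 2 - 2 ≠ 0 := by
      have : 4 ≤ L ^ 2 := by nlinarith
      omega
    have hlt : yr ^ (L ^ 2 - 2) < zr ^ (L ^ 2 - 2) := pow_lt_pow_left₀ hyz hyr0 hn
    exact ⟨by linarith, by positivity⟩
  refine ⟨r, fun L hL => ?_, ratio_tendsto_one hyr0 hyz hsr0.le, fun L _ hL p p' hpp' φ ψ hφm hψm A B hφ0 hφA hψ0 hψB => ?_⟩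
  · obtain ⟨hDlo, hDup⟩ := hrpos L hL
    refine ⟨div_pos hDlo hDup, (div_le_one hDup).mpr ?_⟩
    nlinarith [pow_nonneg hyr0 (L ^ 2 - 2), mul_nonneg hsr0.le (pow_nonneg hyr0 (L ^ 2 - 3))]
  -- MAIN: a fixed volume `L ≥ 2` and a pair `p ≠ p'`
  obtain ⟨hDlo, hDup⟩ := hrpos L hL
  set Dlo : ℝ := zr ^ (L ^ 2 - 2) - yr ^ (L ^ 2 - 2) with hDlodef
  set Dup : ℝ := zr ^ (L ^ 2 - 2) + sr * yr ^ (L ^ 2 - 3) with hDupdef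
  have hrL : r L = Dlo / Dup := rfl
  set μ := wilsonMeasure (d := 2) (L := L) ρ β with hμ
  haveI : IsProbabilityMeasure μ := isProbabilityMeasure_wilsonMeasure (d := 2) (L := L) ρ hρ β
  set π : Measure (GaugeConfig 2 L G) := Measure.pi fun _ : Edge 2 L => haarProbability G with hπ
  -- the density in product form and the partition function
  have hdensprod : ∀ U : GaugeConfig 2 L G, ENNReal.ofReal (Real.exp (-β * wilsonAction ρ U)) =
      ∏ x, (c + v (plaquetteHolonomy U x 0 1)) := fun U => by
    rw [weight_eq_prod_two ρ β U]
    exact Finset.prod_congr rfl fun x _ => (hcv _).symm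
  have hdens : Measurable fun U : GaugeConfig 2 L G => ENNReal.ofReal (Real.exp (-β * wilsonAction ρ U)) := by
    rw [funext hdensprod]
    exact Finset.measurable_prod _ fun x _ => hcvm.comp (measurable_plaquetteHolonomy x)
  have hlin : ∀ {F : GaugeConfig 2 L G → ℝ≥0∞}, Measurable F →
      ∫⁻ U, F U ∂μ = (partitionFunction (d := 2) (L := L) ρ β)⁻¹ *
        ∫⁻ U, F U * ∏ x, (c + v (plaquetteHolonomy U x 0 1)) ∂π := by
    intro F hF
    rw [hμ]
    unfold wilsonMeasure
    rw [lintegral_smul_measure]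
    congr 1
    unfold wilsonWeight
    rw [lintegral_withDensity_eq_lintegral_mul _ hdens hF]
    refine lintegral_congr fun U => ?_
    rw [Pi.mul_apply, hdensprod U, mul_comm]
  have hZ : partitionFunction (d := 2) (L := L) ρ β =
      ∫⁻ U, ∏ x, (c + v (plaquetteHolonomy U x 0 1)) ∂π := by
    unfold partitionFunction wilsonWeight
    rw [withDensity_apply _ MeasurableSet.univ, Measure.restrict_univ]
    exact lintegral_congr fun U => hdensprod U
  set Z := partitionFunction (d := 2) (L := L) ρ β with hZdef
  -- bounds on `Z` (the pair expansion with `Φ = Ψ = 1`)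
  have h1m : Measurable fun _ : G => (1 : ℝ≥0∞) := measurable_const
  have hZU := pair_lintegral_upper hL hpp' c hvm h1m h1m hvs
  have hZL := pair_lintegral_lower hL hpp' c hvm h1m h1m
  simp only [one_mul, hcy] at hZU hZL
  rw [← hπ, ← hZ] at hZU hZL
  -- finiteness
  have hcyt : c + y ≠ ⊤ := ENNReal.add_ne_top.mpr ⟨hct, hyt⟩
  set Uup : ℝ≥0∞ := (c + y) ^ (L ^ 2 - 2) + sE * y ^ (L ^ 2 - 3) with hUup
  have hUupt : Uup ≠ ⊤ := ENNReal.add_ne_top.mpr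
    ⟨ENNReal.pow_ne_top hcyt, ENNReal.mul_ne_top hsEt (ENNReal.pow_ne_top hyt)⟩
  have hUupr : Uup.toReal = Dup := by
    rw [hUup, ENNReal.toReal_add (ENNReal.pow_ne_top hcyt) (ENNReal.mul_ne_top hsEt (ENNReal.pow_ne_top hyt)),
      ENNReal.toReal_pow, ENNReal.toReal_mul, ENNReal.toReal_pow, hcyr, hsEr]
  have hZt : Z ≠ ⊤ := ne_top_of_le_ne_top (ENNReal.mul_ne_top (ENNReal.mul_ne_top hcyt hcyt) hUupt) hZU
  set Zr : ℝ := Z.toReal with hZrdef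
  have hZr_le : Zr ≤ zr * zr * Dup := by
    have h := ENNReal.toReal_mono (ENNReal.mul_ne_top (ENNReal.mul_ne_top hcyt hcyt) hUupt) hZU
    rwa [ENNReal.toReal_mul, ENNReal.toReal_mul, hcyr, hUupr] at h
  have hZr_ge : zr * zr * zr ^ (L ^ 2 - 2) ≤ Zr + zr * zr * yr ^ (L ^ 2 - 2) := by
    have h := ENNReal.toReal_mono (ENNReal.add_ne_top.mpr ⟨hZt,
      ENNReal.mul_ne_top (ENNReal.mul_ne_top hcyt hcyt) (ENNReal.pow_ne_top hyt)⟩) hZL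
    rwa [ENNReal.toReal_add hZt (ENNReal.mul_ne_top (ENNReal.mul_ne_top hcyt hcyt) (ENNReal.pow_ne_top hyt)),
      ENNReal.toReal_mul, ENNReal.toReal_mul, ENNReal.toReal_mul, ENNReal.toReal_mul, ENNReal.toReal_pow,
      ENNReal.toReal_pow, hcyr] at h
  have hZr_lo : zr * zr * Dlo ≤ Zr := by rw [hDlodef]; nlinarith
  have hZr0 : 0 < Zr := lt_of_lt_of_le (by positivity) hZr_lo
  -- THE SANDWICH for a pair of non-negative bounded observables
  set ν : (G → ℝ) → ℝ := fun φ =>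
    (∫⁻ g, ENNReal.ofReal (φ g) * (c + v g) ∂(haarProbability G)).toReal / zr with hν
  have sand : ∀ (φ ψ : G → ℝ) (A B : ℝ), Measurable φ → Measurable ψ →
      (∀ g, 0 ≤ φ g) → (∀ g, φ g ≤ A) → (∀ g, 0 ≤ ψ g) → (∀ g, ψ g ≤ B) →
      (0 ≤ ν φ ∧ ν φ ≤ A) ∧ (0 ≤ ν ψ ∧ ν ψ ≤ B) ∧
      r L * (ν φ * ν ψ) ≤ ∫ U, φ (plaquetteHolonomy U p 0 1) * ψ (plaquetteHolonomy U p' 0 1) ∂μ ∧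
      ∫ U, φ (plaquetteHolonomy U p 0 1) * ψ (plaquetteHolonomy U p' 0 1) ∂μ ≤ (r L)⁻¹ * (ν φ * ν ψ) := by
    intro φ ψ A B hφm hψm hφ0 hφA hψ0 hψB
    have hνφ : ν φ = (∫⁻ g, ENNReal.ofReal (φ g) * (c + v g) ∂(haarProbability G)).toReal / zr := rfl
    have hνψ : ν ψ = (∫⁻ g, ENNReal.ofReal (ψ g) * (c + v g) ∂(haarProbability G)).toReal / zr := rfl
    rw [hνφ, hνψ]
    have hA0 : 0 ≤ A := (hφ0 1).trans (hφA 1)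
    have hB0 : 0 ≤ B := (hψ0 1).trans (hψB 1)
    set Φ : G → ℝ≥0∞ := fun g => ENNReal.ofReal (φ g) with hΦ
    set Ψ : G → ℝ≥0∞ := fun g => ENNReal.ofReal (ψ g) with hΨ
    have hΦm : Measurable Φ := hφm.ennreal_ofReal
    have hΨm : Measurable Ψ := hψm.ennreal_ofReal
    set aE := ∫⁻ g, Φ g * (c + v g) ∂(haarProbability G) with haE
    set bE := ∫⁻ g, Ψ g * (c + v g) ∂(haarProbability G) with hbE
    have haE_le : aE ≤ ENNReal.ofReal A * (c + y) := by
      rw [haE, ← hcy, ← lintegral_const_mul _ hcvm]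
      exact lintegral_mono fun g => mul_le_mul_left (ENNReal.ofReal_le_ofReal (hφA g)) _
    have hbE_le : bE ≤ ENNReal.ofReal B * (c + y) := by
      rw [hbE, ← hcy, ← lintegral_const_mul _ hcvm]
      exact lintegral_mono fun g => mul_le_mul_left (ENNReal.ofReal_le_ofReal (hψB g)) _
    have haEt : aE ≠ ⊤ := ne_top_of_le_ne_top (ENNReal.mul_ne_top ENNReal.ofReal_ne_top hcyt) haE_le
    have hbEt : bE ≠ ⊤ := ne_top_of_le_ne_top (ENNReal.mul_ne_top ENNReal.ofReal_ne_top hcyt) hbE_le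
    set ar := aE.toReal with har
    set br := bE.toReal with hbr
    have har0 : 0 ≤ ar := ENNReal.toReal_nonneg
    have hbr0 : 0 ≤ br := ENNReal.toReal_nonneg
    have harA : ar ≤ A * zr := by
      have h := ENNReal.toReal_mono (ENNReal.mul_ne_top ENNReal.ofReal_ne_top hcyt) haE_le
      rwa [ENNReal.toReal_mul, ENNReal.toReal_ofReal hA0, hcyr] at h
    have hbrB : br ≤ B * zr := by
      have h := ENNReal.toReal_mono (ENNReal.mul_ne_top ENNReal.ofReal_ne_top hcyt) hbE_le
      rwa [ENNReal.toReal_mul, ENNReal.toReal_ofReal hB0, hcyr] at h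
    -- the expansion bounds for the pair
    have hU := pair_lintegral_upper hL hpp' c hvm hΦm hΨm hvs
    have hLo := pair_lintegral_lower hL hpp' c hvm hΦm hΨm
    rw [← haE, ← hbE, ← hπ] at hU hLo
    set NE := ∫⁻ U, Φ (plaquetteHolonomy U p 0 1) * Ψ (plaquetteHolonomy U p' 0 1) *
      ∏ x, (c + v (plaquetteHolonomy U x 0 1)) ∂π with hNE
    have hNEt : NE ≠ ⊤ := ne_top_of_le_ne_top (ENNReal.mul_ne_top (ENNReal.mul_ne_top haEt hbEt) hUupt) hU
    set Nr := NE.toReal with hNr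
    have hNr0 : 0 ≤ Nr := ENNReal.toReal_nonneg
    have hNr_le : Nr ≤ ar * br * Dup := by
      have h := ENNReal.toReal_mono (ENNReal.mul_ne_top (ENNReal.mul_ne_top haEt hbEt) hUupt) hU
      rwa [ENNReal.toReal_mul, ENNReal.toReal_mul, hUupr] at h
    have hNr_ge' : ar * br * zr ^ (L ^ 2 - 2) ≤ Nr + ar * br * yr ^ (L ^ 2 - 2) := by
      have hfin : NE + aE * bE * y ^ (L ^ 2 - 2) ≠ ⊤ := ENNReal.add_ne_top.mpr
        ⟨hNEt, ENNReal.mul_ne_top (ENNReal.mul_ne_top haEt hbEt) (ENNReal.pow_ne_top hyt)⟩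
      have h := ENNReal.toReal_mono hfin hLo
      rwa [ENNReal.toReal_add hNEt (ENNReal.mul_ne_top (ENNReal.mul_ne_top haEt hbEt) (ENNReal.pow_ne_top hyt)),
        ENNReal.toReal_mul, ENNReal.toReal_mul, ENNReal.toReal_mul, ENNReal.toReal_mul, ENNReal.toReal_pow,
        ENNReal.toReal_pow, hcyr] at h
    have hNr_ge : ar * br * Dlo ≤ Nr := by rw [hDlodef]; nlinarith
    -- the real integral is `Nr / Zr`
    have hmeasF : Measurable fun U : GaugeConfig 2 L G =>
        Φ (plaquetteHolonomy U p 0 1) * Ψ (plaquetteHolonomy U p' 0 1) :=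
      (hΦm.comp (measurable_plaquetteHolonomy p)).mul (hΨm.comp (measurable_plaquetteHolonomy p'))
    have hE : ∫ U, φ (plaquetteHolonomy U p 0 1) * ψ (plaquetteHolonomy U p' 0 1) ∂μ = Nr / Zr := by
      rw [integral_eq_lintegral_of_nonneg_ae (ae_of_all _ fun U => mul_nonneg (hφ0 _) (hψ0 _))
        (((hφm.comp (measurable_plaquetteHolonomy p)).mul
          (hψm.comp (measurable_plaquetteHolonomy p'))).aestronglyMeasurable)]
      have h1 : ∫⁻ U, ENNReal.ofReal (φ (plaquetteHolonomy U p 0 1) * ψ (plaquetteHolonomy U p' 0 1)) ∂μ =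
          ∫⁻ U, Φ (plaquetteHolonomy U p 0 1) * Ψ (plaquetteHolonomy U p' 0 1) ∂μ :=
        lintegral_congr fun U => by rw [hΦ, hΨ, ENNReal.ofReal_mul (hφ0 _)]
      rw [h1, hlin hmeasF, ← hNE, ENNReal.toReal_mul, ENNReal.toReal_inv, ← hZrdef, ← hNr,
        div_eq_inv_mul]
    -- assemble
    have hzz : (0 : ℝ) < zr * zr := by positivity
    refine ⟨⟨div_nonneg har0 hzr0.le, (div_le_iff₀ hzr0).mpr harA⟩,
      ⟨div_nonneg hbr0 hzr0.le, (div_le_iff₀ hzr0).mpr hbrB⟩, ?_, ?_⟩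
    · rw [hE, hrL]
      calc Dlo / Dup * (ar / zr * (br / zr)) = (ar * br * Dlo) / (zr * zr * Dup) := by
            field_simp
        _ ≤ Nr / Zr := div_le_div₀ hNr0 hNr_ge hZr0 hZr_le
    · rw [hE, hrL]
      calc Nr / Zr ≤ (ar * br * Dup) / (zr * zr * Dlo) :=
            div_le_div₀ (by positivity) hNr_le (by positivity) hZr_lo
        _ = (Dlo / Dup)⁻¹ * (ar / zr * (br / zr)) := by
            field_simp
  -- the three sandwiches
  have h1r : Measurable fun _ : G => (1 : ℝ) := measurable_const
  obtain ⟨⟨ha0, haA⟩, ⟨hb0, hbB⟩, hX1, hX2⟩ := sand φ ψ A B hφm hψm hφ0 hφA hψ0 hψB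
  obtain ⟨-, ⟨h10, h11⟩, hY1, hY2⟩ := sand φ (fun _ => 1) A 1 hφm h1r hφ0 hφA (fun _ => zero_le_one) (fun _ => le_rfl)
  obtain ⟨-, -, hZ1, hZ2⟩ := sand (fun _ => 1) ψ 1 B h1r hψm (fun _ => zero_le_one) (fun _ => le_rfl) hψ0 hψB
  -- the one-plaquette mean of `1` is `1`
  have hone : ν (fun _ : G => (1 : ℝ)) = 1 := by
    simp only [hν, ENNReal.ofReal_one, one_mul, hcy, hcyr]
    exact div_self hzr0.ne'
  simp only [mul_one, one_mul] at hY1 hY2 hZ1 hZ2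
  rw [hone, mul_one] at hY1 hY2
  rw [hone, one_mul] at hZ1 hZ2
  have hr0 : 0 < r L := by rw [hrL]; exact div_pos hDlo hDup
  have hr1 : r L ≤ 1 := by
    rw [hrL]
    exact (div_le_one hDup).mpr (by
      linarith [hDlodef, hDupdef, pow_nonneg hyr0 (L ^ 2 - 2), mul_nonneg hsr0.le (pow_nonneg hyr0 (L ^ 2 - 3))])
  exact abs_sub_mul_le_of_sandwich hr0 hr1 ha0 hb0 haA hbB hX1 hX2 hY1 hY2 hZ1 hZ2

end Summit.Ventures.LatticeQCDFlow.Theory2.Lattice.TwoDim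

end
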